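import Summits.QuantumFields.BalabanUV.T4Continuum.Support.ShellMeasureWilsonBlock

/-!
# `T4Continuum.ShellMeasureWilsonToy` — non-vacuity of (M1)₀: the abelian one-bond block inhabits every hypothesis of
# `ShellMeasureWilsonBlock.slotAntiConcentration_levelZero`
# (cell `pub-balaban`, sub-cell `t4`, spine estimate NE7c (node U5b); lineage t4-ne7c-p1 = PROVER seat P1
# «shell-measure route», generation 25; file 4 of 4; ADDITIVE — imports `ShellMeasureWilsonBlock` only)

HONEST FRAMING.  A CONSISTENCY CERTIFICATE of the hypothesis set of (M1)₀, nothing more: the `U(1)` one-bond block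
(chart `ℝ`, generator `x·i`, trace datum `Re` with `N = 1`, window `[−1/8, 1/8]`, one interior and one boundary weight
plaquette with the frozen unitary exterior letter `i`, `θ = 1`, `δ = 1/2`, any `β ≥ 0`, any `0 ≤ ρ ≤ 1/4`) satisfies
every hypothesis of `slotAntiConcentration_levelZero`, so the level-0 theorem is not vacuous.  It says NOTHING about
Bałaban's measures; rung (B)+1 finite T⁴ only — NOT infinite volume, NOT mass gap, NOT Clay, NOT summit progress;
(M1) for the inductively defined measures NOT PRINTED (GAPS G-ne7cp1-1); NE7c NOT proved; 0/9 spine.  [folklore],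
0 sorry, 0 citations.
-/

noncomputable section

open NormedSpace Set MeasureTheory

namespace Summit.QuantumFields.BalabanUV.T4Continuum.ShellMeasureWilsonToy

open scoped ENNReal
open Literature.MathematicalPhysics.QuantumFieldTheory.Balaban1983to89
open T4ShellMeasure (SlotAntiConcentration)
open ShellMeasureWilsonWords ShellMeasureWilsonTrace ShellMeasureWilsonBlock

/-! ## The abelian one-bond block -/

section Toy

open ShellMeasureWilsonTrace.Letter

/-- `Re` on `ℂ` (the `U(1)` model, `n = 1`) is a trace datum with `N = 1`. [folklore] -/
def complexTrace : TraceData ℂ where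
  τ z := z.re
  N := 1
  map_add a b := by simp
  map_smul r a := by rw [smul_eq_mul, Complex.re_ofReal_mul]
  comm a b := by rw [mul_comm]
  abs_le a := by rw [one_mul]; exact Complex.abs_re_le_norm a

/-- the generator of the one-bond `U(1)` block at the chart point `x`: `x·i`. [folklore] -/
def toyGen (x : ℝ) : ℂ := (x : ℂ) • Complex.I

/-- ray-linearity of the generator. [folklore] -/
theorem toyGen_smul (c x : ℝ) : toyGen (c * x) = (c : ℂ) * toyGen x := by
  simp only [toyGen, smul_eq_mul, Complex.ofReal_mul, mul_assoc]

/-- `‖x·i‖ = |x|`. [folklore] -/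
theorem norm_toyGen (x : ℝ) : ‖toyGen x‖ = |x| := by simp [toyGen]

/-- the generator is admissible: `Re(x·i) = 0` and `|e^{icx}| = 1`. [folklore] -/
theorem good_toyGen (x : ℝ) : (Letter.gen (toyGen x)).Good complexTrace.τ := by
  refine ⟨by simp [complexTrace, toyGen], fun c _ _ => le_of_eq ?_⟩
  have e : (c : ℂ) • toyGen x = ((c * x : ℝ) : ℂ) * Complex.I := by
    simp only [toyGen, smul_eq_mul, Complex.ofReal_mul]; ring
  rw [e, ← Complex.exp_eq_exp_ℂ, Complex.norm_exp_ofReal_mul_I]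

/-- the classifier plaquette of the toy: the one-letter word `[x·i]`. [folklore] -/
def toyLu : Unit → ℝ → List ℂ := fun _ x => [toyGen x]

/-- the two weight plaquettes of the toy: an interior word `[gen x·i]` and a boundary word `[frozen i, gen x·i]`
(the frozen exterior letter `i` is unitary with deviation `‖i − 1‖ ≤ 2`). [folklore] -/
def toyLw : Fin 2 → ℝ → List (Letter ℂ) :=
  fun p x => if p = 0 then [Letter.gen (toyGen x)] else [Letter.frozen Complex.I, Letter.gen (toyGen x)]

/-- the window `[−1/8, 1/8]` of the toy chart `ℝ`, as the factor `J = 1_W`. [folklore] -/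
def toyJ : ℝ → ℝ≥0∞ := (Icc (-(1 / 8 : ℝ)) (1 / 8)).indicator 1

/-- the toy weight is at most `1` (the Wilson energies are non-negative) and lives on the window, so the sub-threshold
mass is finite. [folklore] -/
theorem toy_fin (β θ : ℝ) (hβ : 0 ≤ β) :
    ((volume : Measure ℝ).withDensity fun x => toyJ x * weight complexTrace β Finset.univ toyLw x)
        {x | classifier Finset.univ_nonempty toyLu x < θ} ≠ ∞ := by
  refine ne_top_of_le_ne_top (b := volume (Icc (-(1 / 8 : ℝ)) (1 / 8))) (by simp [Real.volume_Icc]) ?_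
  refine (measure_mono (subset_univ _)).trans ?_
  rw [withDensity_apply _ MeasurableSet.univ, Measure.restrict_univ, ← lintegral_indicator_one measurableSet_Icc]
  refine lintegral_mono fun x => ?_
  unfold toyJ
  by_cases hx : x ∈ Icc (-(1 / 8 : ℝ)) (1 / 8)
  · rw [indicator_of_mem hx, Pi.one_apply, one_mul]
    unfold weight
    rw [ENNReal.ofReal_le_one, Real.exp_le_one_iff, neg_nonpos]
    unfold action
    refine mul_nonneg hβ (Finset.sum_nonneg fun p _ => ?_)
    have hgood : ∀ ℓ ∈ toyLw p x, ℓ.Good complexTrace.τ := by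
      intro ℓ hℓ
      unfold toyLw at hℓ
      split_ifs at hℓ
      · simp only [List.mem_singleton] at hℓ; rw [hℓ]; exact good_toyGen x
      · simp only [List.mem_cons, List.not_mem_nil, or_false] at hℓ
        rcases hℓ with h | h
        · rw [h]; show ‖Complex.I‖ ≤ 1; simp
        · rw [h]; exact good_toyGen x
    have h1 : ‖wordEval 1 (toyLw p x)‖ ≤ 1 := norm_wordEval_le_one hgood zero_le_one le_rfl
    have h2 : (complexTrace).τ (wordEval 1 (toyLw p x)) ≤ 1 :=
      ((le_abs_self _).trans (Complex.abs_re_le_norm _)).trans h1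
    simp only [complexTrace, div_one] at h2 ⊢
    linarith
  · rw [indicator_of_notMem hx, zero_mul]

/-- **NON-VACUITY OF (M1)₀**: the abelian one-bond block — chart `ℝ`, generator `x·i`, window `[−1/8, 1/8]`, one
interior and one boundary weight plaquette, `θ = 1`, `δ = 1/2`, any `β ≥ 0`, any `0 ≤ ρ ≤ 1/4` — inhabits every
hypothesis of `slotAntiConcentration_levelZero`; in particular the hypothesis set is consistent. [folklore] -/
example {β ρ : ℝ} (hβ : 0 ≤ β) (hρ0 : 0 ≤ ρ) (hρ : ρ ≤ (1 - 1 / 2) / 2) :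
    SlotAntiConcentration
      ((volume : Measure ℝ).withDensity fun x => toyJ x * weight complexTrace β Finset.univ toyLw x)
      (classifier Finset.univ_nonempty toyLu) 1 ρ
      (2 * (Module.finrank ℝ ℝ + β * ∑ p ∈ (Finset.univ : Finset (Fin 2)),
        (fun _ => (1 / 8 : ℝ)) p * ((fun _ => (2 : ℝ)) p + 4 * (fun _ => (1 / 8 : ℝ)) p)) / (1 - 1 / 2)) := by
  refine slotAntiConcentration_levelZero volume complexTrace (by norm_num [complexTrace]) Finset.univ_nonempty toyLu
    Finset.univ toyLw (W := Icc (-(1 / 8 : ℝ)) (1 / 8)) (su := 1 / 8) ?_ ?_ ?_ ?_ ?_ ?_ ?_ ?_ ?_ ?_ ?_ ?_ ?_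
    one_pos (by norm_num) (by norm_num) hρ0 hρ hβ ?_ (toy_fin β 1 hβ)
  · -- ray-linearity of the classifier word
    intro p _ x c _ _
    simp [toyLu, scale, toyGen_smul, smul_eq_mul]
  · -- ray structure of the weight words
    intro p _ x c _ _
    unfold toyLw
    split_ifs <;> simp [wordEval, Letter.eval, toyGen_smul, smul_eq_mul]
  · -- continuity
    intro p _
    simp only [toyLu, wordExp_cons, wordExp_nil, mul_one]
    exact exp_continuous.comp (Complex.continuous_ofReal.smul continuous_const)
  · -- `J` lives on the window
    intro x hx
    by_contra h
    exact hx (indicator_of_notMem h _)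
  · -- `J` is centre-monotone (the window is star-shaped)
    intro x a ha
    unfold toyJ
    by_cases hx : x ∈ Icc (-(1 / 8 : ℝ)) (1 / 8)
    · have hc0 : 0 < Real.exp (-a) := Real.exp_pos _
      have hc1 : Real.exp (-a) ≤ 1 := by rw [Real.exp_le_one_iff]; linarith
      have hx' : Real.exp (-a) • x ∈ Icc (-(1 / 8 : ℝ)) (1 / 8) := by
        rw [mem_Icc] at hx ⊢
        rw [smul_eq_mul]
        constructor <;> nlinarith
      rw [indicator_of_mem hx, indicator_of_mem hx', Pi.one_apply, Pi.one_apply]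
    · rw [indicator_of_notMem hx]; exact bot_le
  · -- generator size of the classifier word on the window
    intro x hx p _
    rw [mem_Icc] at hx
    simp only [toyLu, normSum_cons, normSum_nil, add_zero, norm_toyGen]
    exact abs_le.2 ⟨by linarith, by linarith⟩
  · norm_num
  · -- admissible letters
    intro x _ p _ ℓ hℓ
    unfold toyLw at hℓ
    split_ifs at hℓ
    · simp only [List.mem_singleton] at hℓ; rw [hℓ]; exact good_toyGen x
    · simp only [List.mem_cons, List.not_mem_nil, or_false] at hℓ
      rcases hℓ with h | h
      · rw [h]; show ‖Complex.I‖ ≤ 1; simp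
      · rw [h]; exact good_toyGen x
  · -- generator sizes of the weight words
    intro x hx p _
    rw [mem_Icc] at hx
    have h : |x| ≤ 8⁻¹ := abs_le.2 ⟨by linarith, by linarith⟩
    unfold toyLw
    split_ifs <;> simpa [sGen, Letter.genNorm, norm_toyGen] using h
  · intro p _; norm_num
  · intro p _; norm_num
  · -- frozen deviations of the weight words
    intro x _ p _
    unfold toyLw
    split_ifs
    · simp [dFro, Letter.dev]
    · simp only [dFro, Letter.dev, List.map_cons, List.map_nil, List.sum_cons, List.sum_nil, add_zero]
      calc ‖Complex.I - 1‖ ≤ ‖Complex.I‖ + ‖(1 : ℂ)‖ := norm_sub_le _ _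
        _ = 2 := by simp; norm_num
  · intro p _; norm_num
  · -- (SM)₀: `4·(1/8)²·e^{1/4} ≤ (1/2)·1`
    have h1 : Real.exp (2 * (1 / 8 : ℝ)) ≤ Real.exp 1 := Real.exp_le_exp.2 (by norm_num)
    have h : Real.exp (2 * (1 / 8 : ℝ)) ≤ 3 := h1.trans (by have := Real.exp_one_lt_d9; linarith)
    nlinarith [h, Real.exp_pos (2 * (1 / 8 : ℝ))]

end Toy

end Summit.QuantumFields.BalabanUV.T4Continuum.ShellMeasureWilsonToy
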